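import Summits.RiemannHypothesis.RiemannHypothesis.Theorems.ConnesConsaniSemilocalSoninTraceFormulaOfProp22iii
import Literature.NumberTheory.ConnesConsani2021.CosineTailEnergy
import HarnessLib

/-!
# Route «ConnesConsaniSemilocal», crux K1 `SoninTraceFormula` (stmt-RiemannHypothesis-19305) — CLOSED, UNCONDITIONALLY

RH-FREE corpus statement, now a tree theorem with NO named-fact input (cell `rh-crit/cc`; chain of record cc-lead
R104/R113, director-rh g5 12:13:29Z).  K1 says: the archimedean trace formula of Connes–Consani 2021 Thm. 4.7 in its
Sonin-space form — the δ-series of the scaling operator compressed to Sonin's space is the archimedean distribution of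
Weil's explicit formula.  Both inputs are tree theorems: the ANALYTIC boundary fact Prop. 2.2 (iii) is
`CC2021_prop_2_2_iii_holds` (gm-t13 g2, `CosineTailEnergy.lean` p442107; chain CosineTail / CosineTailLogMoment (t1 g2) /
CutoffScalingKernel / …Energy / …Plancherel (gm-t15) / CosineTailDeltaSquare (t18 g2)), and the transport to the route
item is the seat-g4 helper `CCRouteAdapters.soninTraceFormula_of_prop_2_2_iii` (p436258: Thm. 4.7 weak form of t4
`CC2021_thm_4_7_weak_of_prop_2_2_iii` with the completeness of the even prolate basis discharged by
`CC2021_sec4_xi_complete_holds`, then the K1 adapter `soninTraceFormula_of_thm_4_7_weak`).  Hence the theorem below has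
the route decl as its type and no hypothesis: item stmt-RiemannHypothesis-19305 closes `proved`.
WHAT THIS IS NOT: any claim about RH — K1 is one RH-FREE binder of the route's `closes`, whose conclusion
`WeilArchPositivity_soninTrace_fine` (CC2021 eq. (4)) is RH-FREE and not RH-detecting; the RH-EQUIVALENT residual
`IsolatedCC` is untouched.  Nothing here bears on the truth of RH.
-/

-- `Summit.RiemannHypothesis.RiemannHypothesis.…` duplicates `RiemannHypothesis` BY DESIGN (D-0017).
set_option linter.dupNamespace false

namespace Summit.RiemannHypothesis.RiemannHypothesis.Theorems.ConnesConsaniSemilocalSoninTraceFormula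

open Literature.NumberTheory.LFunctions Literature.NumberTheory.ConnesConsani2021

/-- RH-FREE. **K1 `SoninTraceFormula` HOLDS** (route «ConnesConsaniSemilocal», item stmt-RiemannHypothesis-19305):
Prop. 2.2 (iii) as the tree theorem `CC2021_prop_2_2_iii_holds` through the transport
`CCRouteAdapters.soninTraceFormula_of_prop_2_2_iii`.  The type is LITERALLY the route decl; no hypothesis.
[cite: ConnesConsani2021, Thm. 4.7 §4 p. 18 (= arXiv Thm. 27); Prop. 2.2 (iii) §2 p. 10] -/
theorem soninTraceFormula_proof :
    Summit.RiemannHypothesis.RiemannHypothesis.Theses.ConnesConsaniSemilocal.SoninTraceFormula :=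
  CCRouteAdapters.soninTraceFormula_of_prop_2_2_iii CC2021_prop_2_2_iii_holds

end Summit.RiemannHypothesis.RiemannHypothesis.Theorems.ConnesConsaniSemilocalSoninTraceFormula
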